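import Literature.NumberTheory.Automorphic.FLSResidualImageCriteria
import Literature.NumberTheory.Automorphic.TotallyRealModularitySmallImage
import Literature.NumberTheory.Automorphic.TotallyRealModularityX0Fifteen
import Literature.NumberTheory.Automorphic.SolvableBaseChangeModularity
import Summits.Langlands.Langlands.Theses.SqrtFiveQuarticCovers

/-!
# Sketch — first lemmas of the crux-idea cards for `BoxQuartic` (stmt-Langlands-17836), round 1,
# ideator 1 (planner-cruxidea-stmt-Langlands-17836-1-0). Statements only (Props); nothing proved.
-/

set_option linter.unusedVariables false
set_option linter.dupNamespace false

open scoped MatrixGroups NumberField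
open NumberField Literature.NumberTheory.GaloisRepresentations Literature.NumberTheory.Automorphic

namespace Summit.Langlands.Langlands.Cruxes.BoxQuartic.Sketch

/-! ## Card `lifting-core-certificate` -/

/-- FIRST LEMMA (card 1): the finite conjugacy certificate in `GL₂(𝔽₇)`. For every regular
semisimple non-scalar `g₀ ∈ SL₂(𝔽₇)`, with `C = 𝔽₇[g₀]ˣ` (a Cartan subgroup), the index-2 subgroup
`M(g₀) = {g ∈ N(C) : g ∈ C ↔ det g square}` of the normaliser is conjugate into
`H₁ = FLS2015.subgroupD7` or into `H₂ = FLS2015.subgroupE7 = G(e7)`.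
(Checked exhaustively outside Lean: folder `compute/cartan7_certificate_all.py`, 238 `g₀`, all OK;
`|M| = 36` and `P M P⁻¹ = H₁` when `tr(g₀)² - 4` is a square, `|M| = 48` and `P M P⁻¹ = H₂` otherwise.) -/
def CartanIndexTwoCertificate7 : Prop :=
  ∀ [Fact (Nat.Prime 7)] (g₀ : GL (Fin 2) (ZMod 7)), Matrix.GeneralLinearGroup.det g₀ = 1 →
    (∀ s : ZMod 7, (g₀ : Matrix (Fin 2) (Fin 2) (ZMod 7)) ≠ s • 1) →
    (g₀ : Matrix (Fin 2) (Fin 2) (ZMod 7)).trace ^ 2 - 4 * (g₀ : Matrix (Fin 2) (Fin 2) (ZMod 7)).det ≠ 0 →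
    ∃ P : GL (Fin 2) (ZMod 7),
      (∀ g ∈ Subgroup.normalizer
          (Serre1972.unitGroup (Serre1972.adjoinElem (g₀ : Matrix (Fin 2) (Fin 2) (ZMod 7))) :
            Set (GL (Fin 2) (ZMod 7))),
        (g ∈ Serre1972.unitGroup (Serre1972.adjoinElem (g₀ : Matrix (Fin 2) (Fin 2) (ZMod 7))) ↔
            IsSquare (g : Matrix (Fin 2) (Fin 2) (ZMod 7)).det) →
          P * g * P⁻¹ ∈ FLS2015.subgroupD7) ∨
      (∀ g ∈ Subgroup.normalizer
          (Serre1972.unitGroup (Serre1972.adjoinElem (g₀ : Matrix (Fin 2) (Fin 2) (ZMod 7))) :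
            Set (GL (Fin 2) (ZMod 7))),
        (g ∈ Serre1972.unitGroup (Serre1972.adjoinElem (g₀ : Matrix (Fin 2) (Fin 2) (ZMod 7))) ↔
            IsSquare (g : Matrix (Fin 2) (Fin 2) (ZMod 7)).det) →
          P * g * P⁻¹ ∈ FLS2015.subgroupE7)

/-- Card 1, second step: the certificate DISCHARGES the named fact `FLS2015_prop9_1c` (through the
tree's proved odd-normaliser lemma `FLS2015.exists_le_normalizer_unitGroup_adjoinElem`). -/
def CertificateDischargesProp91c : Prop :=
  CartanIndexTwoCertificate7 → FLS2015_prop9_1c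

/-- Thorne 2016, Thm. 7.6 (= his Thm. 1.1) as a STANDALONE statement (to be vendored as its own named
fact; today the tree derives it from `Box2022_theorem1_3` (ii), inverting the printed dependency):
`F` totally real, `√5 ∉ F`, `E` with no `F`-rational `5`-isogeny ⇒ `E` modular. -/
def Thorne2016Theorem76 : Prop :=
  ∀ [Fact (Nat.Prime 5)] (F : Type) [Field F] [NumberField F] [IsTotallyReal F], ¬ IsSquare (5 : F) →
    ∀ E : WeierstrassCurve (𝓞 F), E.Δ ≠ 0 →
      (E.baseChange F).HasIrreducibleModPGaloisRep 5 → IsAutomorphicOfWeightZero E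

/-- Card 1, the line's target conditional: `BoxQuartic` from the four printed lifting theorems
(FLS Thm. 3, FLS Thm. 4, Kalyanswamy Thm. 1.2, Thorne Thm. 7.6) and Box's quartic-points theorem
(Thm. 1.5 with 1.4), with ALL finite group theory and cyclotomic field theory kernel-checked
(`FLS2015_prop9_1c` being proved by the certificate, not assumed). -/
def BoxQuarticOfLiftingTheorems : Prop :=
  FLS2015_theorem3 → FLS2015_theorem4 → Kalyanswamy2018_theorem1_2 → Thorne2016Theorem76 →
    Box2022_theorem1_5_modular →
      Summit.Langlands.Langlands.Theses.SqrtFiveQuarticCovers.BoxQuartic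

/-! ## Card `j-degree-filter` -/

/-- FIRST LEMMA (card 2): the `j`-degree trichotomy over a quartic field — for `j ∈ K`,
`[ℚ(j) : ℚ] ∈ {1, 2, 4}` (tower law). -/
def JDegreeTrichotomy : Prop :=
  ∀ (K : Type) [Field K] [NumberField K], Module.finrank ℚ K = 4 → ∀ j : K,
    Module.finrank ℚ (IntermediateField.adjoin ℚ ({j} : Set K)) = 1 ∨
      Module.finrank ℚ (IntermediateField.adjoin ℚ ({j} : Set K)) = 2 ∨
        Module.finrank ℚ (IntermediateField.adjoin ℚ ({j} : Set K)) = 4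

/-- Card 2, second kernel lemma: the symmetric group on four letters is solvable (hence so is the
Galois group of the normal closure of any field of degree `≤ 4`, which embeds in it) — the reason
Langlands' CYCLIC base change / descent (no potential automorphy) suffices to move modularity from
`ℚ` or a quadratic field up to an arbitrary quartic field. Not in Mathlib (only `fin_5_not_solvable`). -/
def PermFinFourSolvable : Prop :=
  IsSolvable (Equiv.Perm (Fin 4))

/-- Card 2, the restructured Diophantine fact (Box 2022, Thm. 1.5 with 1.4, QUARTIC-`j` core only):
as `Box2022_theorem1_5_modular` but with the extra hypothesis `[ℚ(j(E)) : ℚ] = 4`, `j = c₄³/Δ`. -/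
def Box2022Theorem15QuarticJ : Prop :=
  ∀ (K : Type) [Field K] [NumberField K] [IsTotallyReal K], Module.finrank ℚ K = 4 →
    ∀ E : WeierstrassCurve (𝓞 K), E.Δ ≠ 0 →
      Module.finrank ℚ (IntermediateField.adjoin ℚ
        ({(algebraMap (𝓞 K) K E.c₄) ^ 3 / algebraMap (𝓞 K) K E.Δ} : Set K)) = 4 →
      (∃ ρ : FramedGaloisRep K (ZMod 3) 2, (E.baseChange K).IsTorsionGaloisRep 3 ρ ∧
        ((∀ σ : Field.absoluteGaloisGroup K,
            ((ρ σ : GL (Fin 2) (ZMod 3)) : Matrix (Fin 2) (Fin 2) (ZMod 3)) 1 0 = 0) ∨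
          (∀ σ : Field.absoluteGaloisGroup K, (ρ σ : GL (Fin 2) (ZMod 3)) ∈
            Subgroup.closure ({(⟨!![1, 0; 0, 2], !![1, 0; 0, 2], by decide, by decide⟩ :
                GL (Fin 2) (ZMod 3)),
              (⟨!![0, 1; 1, 0], !![0, 1; 1, 0], by decide, by decide⟩ : GL (Fin 2) (ZMod 3))} :
              Set (GL (Fin 2) (ZMod 3)))))) →
      (∃ ρ : FramedGaloisRep K (ZMod 5) 2, (E.baseChange K).IsTorsionGaloisRep 5 ρ ∧
        ∀ σ : Field.absoluteGaloisGroup K,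
          ((ρ σ : GL (Fin 2) (ZMod 5)) : Matrix (Fin 2) (Fin 2) (ZMod 5)) 1 0 = 0) →
      (∃ ρ : FramedGaloisRep K (ZMod 7) 2, (E.baseChange K).IsTorsionGaloisRep 7 ρ ∧
        ((∀ σ : Field.absoluteGaloisGroup K,
            ((ρ σ : GL (Fin 2) (ZMod 7)) : Matrix (Fin 2) (Fin 2) (ZMod 7)) 1 0 = 0) ∨
          (∀ σ : Field.absoluteGaloisGroup K, (ρ σ : GL (Fin 2) (ZMod 7)) ∈
            Subgroup.closure ({(⟨!![0, 5; 3, 0], !![0, 5; 3, 0], by decide, by decide⟩ :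
                GL (Fin 2) (ZMod 7)),
              (⟨!![5, 0; 3, 2], !![3, 0; 6, 4], by decide, by decide⟩ : GL (Fin 2) (ZMod 7))} :
              Set (GL (Fin 2) (ZMod 7)))))) →
      IsAutomorphicOfWeightZero E

/-- Base change of elliptic curves over `ℚ` to a totally real field with SOLVABLE NORMAL CLOSURE
(Thorne 2016, Lemma 7.1, BOTH bullets: soluble base change up to the closure, soluble descent back
down) — the generalisation of the tree's `isModularEllipticCurve_baseChange_rat_of_isSolvable`
(which asks `K/ℚ` itself Galois) that a non-Galois quartic field needs. -/
def BaseChangeRatOfSolvableClosure : Prop :=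
  ∀ (K L : Type) [Field K] [NumberField K] [IsTotallyReal K] [Field L] [NumberField L]
    [Algebra K L] [IsGalois ℚ L] [IsSolvable (L ≃ₐ[ℚ] L)] (E₀ : WeierstrassCurve ℤ), E₀.Δ ≠ 0 →
      IsModularEllipticCurve K (E₀.baseChange (𝓞 K))

/-- Card 2, the line's target conditional: `Box2022_theorem1_5_modular` (hence stub 3 of `birth`,
hence — with card 1 or `birth` — `BoxQuartic`) from the quartic-`j` core, the degree-1 inputs
(BCDT + soluble base change/descent, twist invariance — tree facts, the first generalised) and the
degree-2 input (FLS Thm. 1 + quadratic base change + twist), glued by `JDegreeTrichotomy` and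
`PermFinFourSolvable`. The degree-2 base-change input is left as the hypothesis `hQuad` in words:
"`E` over `𝓞 K` with `Δ ≠ 0` and `[ℚ(j(E)):ℚ] = 2` is modular" (FLS Thm. 1 + Langlands for `K/ℚ(j)`). -/
def Theorem15ModularOfQuarticJCore : Prop :=
  Box2022Theorem15QuarticJ → BaseChangeRatOfSolvableClosure →
    isModularEllipticCurve_of_jInvariant_eq →
    (∀ (K : Type) [Field K] [NumberField K] [IsTotallyReal K], Module.finrank ℚ K = 4 →
      ∀ E : WeierstrassCurve (𝓞 K), E.Δ ≠ 0 →
        Module.finrank ℚ (IntermediateField.adjoin ℚ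
          ({(algebraMap (𝓞 K) K E.c₄) ^ 3 / algebraMap (𝓞 K) K E.Δ} : Set K)) = 2 →
        IsModularEllipticCurve K E) →
    ∀ (K : Type) [Field K] [NumberField K] [IsTotallyReal K], Module.finrank ℚ K = 4 →
      ∀ E : WeierstrassCurve (𝓞 K), E.Δ ≠ 0 →
      (∃ ρ : FramedGaloisRep K (ZMod 3) 2, (E.baseChange K).IsTorsionGaloisRep 3 ρ ∧
        ((∀ σ : Field.absoluteGaloisGroup K,
            ((ρ σ : GL (Fin 2) (ZMod 3)) : Matrix (Fin 2) (Fin 2) (ZMod 3)) 1 0 = 0) ∨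
          (∀ σ : Field.absoluteGaloisGroup K, (ρ σ : GL (Fin 2) (ZMod 3)) ∈
            Subgroup.closure ({(⟨!![1, 0; 0, 2], !![1, 0; 0, 2], by decide, by decide⟩ :
                GL (Fin 2) (ZMod 3)),
              (⟨!![0, 1; 1, 0], !![0, 1; 1, 0], by decide, by decide⟩ : GL (Fin 2) (ZMod 3))} :
              Set (GL (Fin 2) (ZMod 3)))))) →
      (∃ ρ : FramedGaloisRep K (ZMod 5) 2, (E.baseChange K).IsTorsionGaloisRep 5 ρ ∧
        ∀ σ : Field.absoluteGaloisGroup K,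
          ((ρ σ : GL (Fin 2) (ZMod 5)) : Matrix (Fin 2) (Fin 2) (ZMod 5)) 1 0 = 0) →
      (∃ ρ : FramedGaloisRep K (ZMod 7) 2, (E.baseChange K).IsTorsionGaloisRep 7 ρ ∧
        ((∀ σ : Field.absoluteGaloisGroup K,
            ((ρ σ : GL (Fin 2) (ZMod 7)) : Matrix (Fin 2) (Fin 2) (ZMod 7)) 1 0 = 0) ∨
          (∀ σ : Field.absoluteGaloisGroup K, (ρ σ : GL (Fin 2) (ZMod 7)) ∈
            Subgroup.closure ({(⟨!![0, 5; 3, 0], !![0, 5; 3, 0], by decide, by decide⟩ :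
                GL (Fin 2) (ZMod 7)),
              (⟨!![5, 0; 3, 2], !![3, 0; 6, 4], by decide, by decide⟩ : GL (Fin 2) (ZMod 7))} :
              Set (GL (Fin 2) (ZMod 7)))))) →
      IsModularEllipticCurve K E

end Summit.Langlands.Langlands.Cruxes.BoxQuartic.Sketch
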